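import Mathlib
import Literature.Computability.AlgebraicComplexity.BCGPUInfiniteGroups

/-!
# The incidence inequality for TPP designs, and Bruhat-cell ("flip") designs

Setting: Blasiak–Cohn–Grochow–Pratt–Umans (arXiv:2410.14905) Def. 2.1 / Thm. 2.2 — a group `G`,
finite `X, Y, Z ⊆ G` with the TPP in embedding form (as in the tree's
`BCGPU2024_thm_2_2_corrected`) and a separating family (`IsSeparatingFamily`, tree) inside a
finite-dimensional space `V` of functions `G → ℂ` (Lie door: `V = ℂ[M_n]_{≤ s}|GL_n`,
`dim V = C(s+n², n²)`).  `Q = X Z⁻¹`; `N ⊆ X Y⁻¹ Y Z⁻¹ ∖ Q` a set of twisted points;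
`h_V(S) = dim V|_S`.

**New here (soloist).**
1. *Incidence inequality* (`card_mul_add_finrank_restrict_le`): `|X|·|Z| + h_V(N) ≤ dim V` — the
   separating functions are `|X||Z|` independent elements of `ker (V → ℂ^N)`.  For one twist
   `w = y⁻¹y' ≠ 1`: `|X||Z| + h_V(X w Z⁻¹) ≤ dim V` (`card_mul_add_finrank_twist_le`).  Reading: a
   design of volume `> dim V` (the super-density the Lie door needs with exponent `3/2 − o(1)`,
   BCGPU Rem. 2.3) must have EVERY twisted copy `X w Z⁻¹` of `Q` (`|Q|` points) imposing at most
   `dim V − |Q|` conditions on `V`: all twists algebraically degenerate.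
2. *Cell-function designs* (`tpp_of_cellFunction`, `isSeparatingFamily_of_cellFunction`): if `φ`
   vanishes at every twisted point and at no point of `Q`, the TPP reduces to injectivity of
   `(x, z) ↦ x z⁻¹`, and `φ · (interpolant on Q)` separates.  Instance (`glTwo_flip_tpp`,
   `glTwo_flip_separating`): `G = GL₂(ℂ)`, `X ⊆ B⁻`, `Z⁻¹ ⊆ U⁺`, `Y = {1, σ}` (`σ` the flip),
   `φ(g) = g₁₁` (kills the Bruhat cell `B⁻σB⁺`): volume `2|X||Z|`, separators
   `g₁₁ · (degree s−1 interpolant)`, so up to `2·C(s+3,4) → 2·dim V_s`.  A computation (soloist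
   job j070852; s = 6: `|X| = 28`, `|Z| = 4`, volume `224 > 210 = C(10,4)`) makes these the
   first `GL₂`-door designs above the trivial level `dim V_s` — by a factor `< 2`, hence still
   exponent `4` (`ω ≤ 6` via Cor. 2.8).

References: [BlasiakCohnGrochowPrattUmans2024] arXiv:2410.14905, Def. 2.1, Thm. 2.2, Rem. 2.3,
Cor. 2.8, §4 (open problem: a fixed group with growing designs).
-/

noncomputable section

open scoped BigOperators
open Module

namespace Summit.MatrixMultiplication.MatrixMultiplication.Theorems

open Literature.Computability.AlgebraicComplexity

variable {G : Type*}

/-! ## 1. The incidence inequality -/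

/-- Restriction of functions `G → ℂ` to a finite set `S`. [folklore] -/
def restrictFun (S : Finset G) : (G → ℂ) →ₗ[ℂ] (S → ℂ) :=
  LinearMap.funLeft ℂ ℂ ((↑) : S → G)

/-- `restrictFun` is evaluation. [folklore] -/
@[simp] theorem restrictFun_apply (S : Finset G) (φ : G → ℂ) (t : S) :
    restrictFun S φ t = φ t := rfl

variable [Group G]

/-- **Incidence inequality.** `V` finite-dimensional, `X, Y, Z` a TPP triple (embedding form) with
`Y ≠ ∅` and a separating family inside `V`; `N` any finite set of twisted points
`x' y⁻¹ y' z'⁻¹` none of which lies in `Q = X Z⁻¹`.  Then `|X||Z| + dim(V|_N) ≤ dim V`.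
[new; cf. BlasiakCohnGrochowPrattUmans2024, Def. 2.1] -/
theorem card_mul_add_finrank_restrict_le (V : Submodule ℂ (G → ℂ)) [FiniteDimensional ℂ V]
    {X Y Z : Finset G} (hY : Y.Nonempty)
    (hTPP : ∀ x ∈ X, ∀ x' ∈ X, ∀ y ∈ Y, ∀ y' ∈ Y, ∀ z ∈ Z, ∀ z' ∈ Z,
      x * y⁻¹ * y' * z⁻¹ = x' * z'⁻¹ → x = x' ∧ y = y' ∧ z = z')
    (f : G → G → (G → ℂ)) (hf : IsSeparatingFamily X Y Z f)
    (hfV : ∀ x ∈ X, ∀ z ∈ Z, f x z ∈ V)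
    (N : Finset G)
    (hN : ∀ t ∈ N, ∃ x' ∈ X, ∃ y ∈ Y, ∃ y' ∈ Y, ∃ z' ∈ Z, t = x' * y⁻¹ * y' * z'⁻¹)
    (hNQ : ∀ t ∈ N, ∀ x ∈ X, ∀ z ∈ Z, t ≠ x * z⁻¹) :
    X.card * Z.card + finrank ℂ (V.map (restrictFun N)) ≤ finrank ℂ V := by
  classical
  obtain ⟨y₀, hy₀⟩ := hY
  -- the restriction map on `V`
  let r : V →ₗ[ℂ] (N → ℂ) := (restrictFun N).domRestrict V
  have hrange : LinearMap.range r = V.map (restrictFun N) := by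
    show LinearMap.range ((restrictFun N).comp V.subtype) = _
    rw [LinearMap.range_comp, Submodule.range_subtype]
  have hrn : finrank ℂ (LinearMap.range r) + finrank ℂ (LinearMap.ker r) = finrank ℂ V :=
    LinearMap.finrank_range_add_finrank_ker r
  -- index type: the finset `X × Z`
  set I : Finset (G × G) := X ×ˢ Z with hI
  have hmemI : ∀ p ∈ I, p.1 ∈ X ∧ p.2 ∈ Z := fun p hp => by
    simpa [hI, Finset.mem_product] using hp
  -- the separating functions and their dual points
  let F : I → (G → ℂ) := fun p => f p.1.1 p.1.2
  let q : I → G := fun p => p.1.1 * (p.1.2)⁻¹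
  have key : ∀ p p' : I, F p (q p') = if p = p' then 1 else 0 := by
    rintro ⟨⟨x, z⟩, hp⟩ ⟨⟨x', z'⟩, hp'⟩
    obtain ⟨hx, hz⟩ := hmemI _ hp
    obtain ⟨hx', hz'⟩ := hmemI _ hp'
    show f x z (x' * z'⁻¹) = _
    by_cases heq : x' * y₀⁻¹ * y₀ * z'⁻¹ = x * z⁻¹
    · obtain ⟨h1, -, h3⟩ := hTPP x' hx' x hx y₀ hy₀ y₀ hy₀ z' hz' z hz heq
      subst h1; subst h3
      rw [(hf x' hx' z' hz').1]
      simp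
    · have hval := (hf x hx z hz).2 x' hx' y₀ hy₀ y₀ hy₀ z' hz' heq
      have harg : x' * y₀⁻¹ * y₀ * z'⁻¹ = x' * z'⁻¹ := by group
      rw [harg] at hval
      rw [hval]
      have hne : (⟨(x, z), hp⟩ : I) ≠ ⟨(x', z'), hp'⟩ := by
        intro h
        simp only [Subtype.mk.injEq, Prod.mk.injEq] at h
        obtain ⟨rfl, rfl⟩ := h
        exact heq (by group)
      simp [hne]
  have hli0 : LinearIndependent ℂ F := by
    rw [linearIndependent_iff']
    intro S c hc p hp
    have h := congrArg (fun v : G → ℂ => v (q p)) hc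
    simp only [Finset.sum_apply, Pi.smul_apply, smul_eq_mul, Pi.zero_apply] at h
    rw [Finset.sum_eq_single p] at h
    · simpa [key] using h
    · intro p' _ hp'
      rw [key p' p]
      simp [hp']
    · exact fun hp' => absurd hp hp'
  -- they lie in the kernel of `r`
  have hker : ∀ p : I, (⟨F p, hfV _ (hmemI p.1 p.2).1 _ (hmemI p.1 p.2).2⟩ : V) ∈
      LinearMap.ker r := by
    rintro ⟨⟨x, z⟩, hp⟩
    obtain ⟨hx, hz⟩ := hmemI _ hp
    rw [LinearMap.mem_ker]
    funext t
    obtain ⟨x', hx', y, hy, y', hy', z', hz', ht⟩ := hN t t.2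
    have hne : x' * y⁻¹ * y' * z'⁻¹ ≠ x * z⁻¹ := fun h => hNQ t t.2 x hx z hz (ht.trans h)
    show f x z (t : G) = 0
    rw [ht]
    exact (hf x hx z hz).2 x' hx' y hy y' hy' z' hz' hne
  let tf : I → LinearMap.ker r := fun p => ⟨_, hker p⟩
  have hli : LinearIndependent ℂ tf := by
    refine LinearIndependent.of_comp (V.subtype ∘ₗ (LinearMap.ker r).subtype) ?_
    exact hli0
  have hcard : Fintype.card I = X.card * Z.card := by
    rw [Fintype.card_coe, hI, Finset.card_product]
  have hle : X.card * Z.card ≤ finrank ℂ (LinearMap.ker r) := by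
    rw [← hcard]; exact hli.fintype_card_le_finrank
  rw [← hrange, ← hrn]
  omega

/-- The set of points twisted by one quotient `w = y⁻¹ y'`: `X w Z⁻¹`. [new] -/
def twistSet [DecidableEq G] (X Z : Finset G) (w : G) : Finset G :=
  (X ×ˢ Z).image fun p => p.1 * w * p.2⁻¹

/-- **Single-twist inequality.** For `y ≠ y'` in `Y`:  `|X||Z| + dim(V|_{X y⁻¹y' Z⁻¹}) ≤ dim V`.
So if one twisted copy of `Q` is as independent as `|Q|` points can be, `|X||Z| ≤ dim V / 2`;
super-dense designs need every twist degenerate. [new] -/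
theorem card_mul_add_finrank_twist_le [DecidableEq G] (V : Submodule ℂ (G → ℂ))
    [FiniteDimensional ℂ V] {X Y Z : Finset G}
    (hTPP : ∀ x ∈ X, ∀ x' ∈ X, ∀ y ∈ Y, ∀ y' ∈ Y, ∀ z ∈ Z, ∀ z' ∈ Z,
      x * y⁻¹ * y' * z⁻¹ = x' * z'⁻¹ → x = x' ∧ y = y' ∧ z = z')
    (f : G → G → (G → ℂ)) (hf : IsSeparatingFamily X Y Z f)
    (hfV : ∀ x ∈ X, ∀ z ∈ Z, f x z ∈ V) {y y' : G} (hy : y ∈ Y) (hy' : y' ∈ Y) (hne : y ≠ y') :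
    X.card * Z.card + finrank ℂ (V.map (restrictFun (twistSet X Z (y⁻¹ * y')))) ≤
      finrank ℂ V := by
  refine card_mul_add_finrank_restrict_le V ⟨y, hy⟩ hTPP f hf hfV _ ?_ ?_
  · intro t ht
    obtain ⟨⟨x', z'⟩, hp, rfl⟩ := Finset.mem_image.1 ht
    obtain ⟨hx', hz'⟩ := Finset.mem_product.1 hp
    refine ⟨x', hx', y, hy, y', hy', z', hz', ?_⟩
    show x' * (y⁻¹ * y') * z'⁻¹ = x' * y⁻¹ * y' * z'⁻¹
    group
  · intro t ht x hx z hz heq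
    obtain ⟨⟨x', z'⟩, hp, rfl⟩ := Finset.mem_image.1 ht
    obtain ⟨hx', hz'⟩ := Finset.mem_product.1 hp
    have h' : x' * y⁻¹ * y' * z'⁻¹ = x * z⁻¹ := by
      rw [← heq]
      show x' * y⁻¹ * y' * z'⁻¹ = x' * (y⁻¹ * y') * z'⁻¹
      group
    exact hne (hTPP x' hx' x hx y hy y' hy' z' hz' z hz h').2.1

/-- The case `N = ∅`: `|X||Z| ≤ dim V` (the third flattening bound, needing no invariance of `V`).
[folklore; cf. BlasiakCohnGrochowPrattUmans2024, Thm. 2.2] -/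
theorem card_mul_le_finrank_of_separating (V : Submodule ℂ (G → ℂ)) [FiniteDimensional ℂ V]
    {X Y Z : Finset G} (hY : Y.Nonempty)
    (hTPP : ∀ x ∈ X, ∀ x' ∈ X, ∀ y ∈ Y, ∀ y' ∈ Y, ∀ z ∈ Z, ∀ z' ∈ Z,
      x * y⁻¹ * y' * z⁻¹ = x' * z'⁻¹ → x = x' ∧ y = y' ∧ z = z')
    (f : G → G → (G → ℂ)) (hf : IsSeparatingFamily X Y Z f)
    (hfV : ∀ x ∈ X, ∀ z ∈ Z, f x z ∈ V) :
    X.card * Z.card ≤ finrank ℂ V := by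
  have h := card_mul_add_finrank_restrict_le V hY hTPP f hf hfV ∅ (by simp) (by simp)
  omega

/-! ## 2. Cell-function designs -/

/-- **TPP from a cell function.** If `φ` vanishes at all twisted points `x y⁻¹ y' z⁻¹` (`y ≠ y'`)
and at no point `x z⁻¹`, then the TPP (embedding form) reduces to the injectivity of
`(x, z) ↦ x z⁻¹` on `X × Z`. [new] -/
theorem tpp_of_cellFunction (φ : G → ℂ) {X Y Z : Finset G}
    (hφN : ∀ x ∈ X, ∀ y ∈ Y, ∀ y' ∈ Y, ∀ z ∈ Z, y ≠ y' → φ (x * y⁻¹ * y' * z⁻¹) = 0)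
    (hφQ : ∀ x ∈ X, ∀ z ∈ Z, φ (x * z⁻¹) ≠ 0)
    (hinj : ∀ x ∈ X, ∀ x' ∈ X, ∀ z ∈ Z, ∀ z' ∈ Z, x * z⁻¹ = x' * z'⁻¹ → x = x' ∧ z = z') :
    ∀ x ∈ X, ∀ x' ∈ X, ∀ y ∈ Y, ∀ y' ∈ Y, ∀ z ∈ Z, ∀ z' ∈ Z,
      x * y⁻¹ * y' * z⁻¹ = x' * z'⁻¹ → x = x' ∧ y = y' ∧ z = z' := by
  intro x hx x' hx' y hy y' hy' z hz z' hz' heq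
  by_cases hyy : y = y'
  · subst hyy
    have h2 : x * z⁻¹ = x' * z'⁻¹ := by rw [← heq]; group
    obtain ⟨h1, h3⟩ := hinj x hx x' hx' z hz z' hz' h2
    exact ⟨h1, rfl, h3⟩
  · exfalso
    have h0 := hφN x hx y hy y' hy' z hz hyy
    rw [heq] at h0
    exact hφQ x' hx' z' hz' h0

/-- **Separation from a cell function.** With `φ` as above and an interpolating family `g` on
`Q = X Z⁻¹` (`g_{xz}(x' z'⁻¹) = [x = x'][z = z']`), the functions
`f_{xz} = φ(x z⁻¹)⁻¹ · φ · g_{xz}` form a separating family (BCGPU Def. 2.1). [new] -/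
theorem isSeparatingFamily_of_cellFunction [DecidableEq G] (φ : G → ℂ) {X Y Z : Finset G}
    (hφN : ∀ x ∈ X, ∀ y ∈ Y, ∀ y' ∈ Y, ∀ z ∈ Z, y ≠ y' → φ (x * y⁻¹ * y' * z⁻¹) = 0)
    (hφQ : ∀ x ∈ X, ∀ z ∈ Z, φ (x * z⁻¹) ≠ 0)
    (g : G → G → (G → ℂ))
    (hg : ∀ x ∈ X, ∀ z ∈ Z, ∀ x' ∈ X, ∀ z' ∈ Z,
      g x z (x' * z'⁻¹) = if x = x' ∧ z = z' then 1 else 0) :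
    IsSeparatingFamily X Y Z (fun x z t => (φ (x * z⁻¹))⁻¹ * (φ t * g x z t)) := by
  intro x hx z hz
  refine ⟨?_, ?_⟩
  · show (φ (x * z⁻¹))⁻¹ * (φ (x * z⁻¹) * g x z (x * z⁻¹)) = 1
    have h1 : g x z (x * z⁻¹) = 1 := by rw [hg x hx z hz x hx z hz]; simp
    rw [h1, mul_one, inv_mul_cancel₀ (hφQ x hx z hz)]
  · intro x' hx' y hy y' hy' z' hz' hne
    show (φ (x * z⁻¹))⁻¹ * (φ (x' * y⁻¹ * y' * z'⁻¹) * g x z (x' * y⁻¹ * y' * z'⁻¹)) = 0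
    by_cases hyy : y = y'
    · subst hyy
      have harg : x' * y⁻¹ * y * z'⁻¹ = x' * z'⁻¹ := by group
      rw [harg] at hne ⊢
      have h0 : g x z (x' * z'⁻¹) = 0 := by
        rw [hg x hx z hz x' hx' z' hz']
        have : ¬ (x = x' ∧ z = z') := by
          rintro ⟨rfl, rfl⟩; exact hne rfl
        simp [this]
      rw [h0]; simp
    · rw [hφN x' hx' y hy y' hy' z' hz' hyy]; simp

/-- Volume of a cell-function design inside `V`: if `φ · g_{xz} ∈ V` for an interpolating family
`g` on `Q`, then `X, Y, Z` is a TPP design with a separating family in `V` — so everything proved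
from BCGPU Thm. 2.2 applies to it, with volume `|X| · |Y| · |Z|`; recorded together with the
packing consequence `|X||Z| ≤ dim V`. [new] -/
theorem cellFunction_design [DecidableEq G] (V : Submodule ℂ (G → ℂ)) [FiniteDimensional ℂ V]
    (φ : G → ℂ) {X Y Z : Finset G} (hY : Y.Nonempty)
    (hφN : ∀ x ∈ X, ∀ y ∈ Y, ∀ y' ∈ Y, ∀ z ∈ Z, y ≠ y' → φ (x * y⁻¹ * y' * z⁻¹) = 0)
    (hφQ : ∀ x ∈ X, ∀ z ∈ Z, φ (x * z⁻¹) ≠ 0)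
    (hinj : ∀ x ∈ X, ∀ x' ∈ X, ∀ z ∈ Z, ∀ z' ∈ Z, x * z⁻¹ = x' * z'⁻¹ → x = x' ∧ z = z')
    (g : G → G → (G → ℂ))
    (hg : ∀ x ∈ X, ∀ z ∈ Z, ∀ x' ∈ X, ∀ z' ∈ Z,
      g x z (x' * z'⁻¹) = if x = x' ∧ z = z' then 1 else 0)
    (hgV : ∀ x ∈ X, ∀ z ∈ Z, (fun t => φ t * g x z t) ∈ V) :
    (∀ x ∈ X, ∀ x' ∈ X, ∀ y ∈ Y, ∀ y' ∈ Y, ∀ z ∈ Z, ∀ z' ∈ Z,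
      x * y⁻¹ * y' * z⁻¹ = x' * z'⁻¹ → x = x' ∧ y = y' ∧ z = z') ∧
    IsSeparatingFamily X Y Z (fun x z t => (φ (x * z⁻¹))⁻¹ * (φ t * g x z t)) ∧
    X.card * Z.card ≤ finrank ℂ V := by
  have hT := tpp_of_cellFunction φ hφN hφQ hinj
  have hS := isSeparatingFamily_of_cellFunction φ hφN hφQ g hg
  refine ⟨hT, hS, card_mul_le_finrank_of_separating V hY hT _ hS fun x hx z hz => ?_⟩
  have : (fun t => (φ (x * z⁻¹))⁻¹ * (φ t * g x z t)) =
      (φ (x * z⁻¹))⁻¹ • (fun t => φ t * g x z t) := by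
    funext t; simp [Pi.smul_apply]
  rw [this]
  exact V.smul_mem _ (hgV x hx z hz)

/-! ## 3. The flip design in `GL₂(ℂ)` -/

/-- `GL₂(ℂ)`. -/
abbrev GLTwo' : Type := Matrix.GeneralLinearGroup (Fin 2) ℂ

/-- The flip `σ = [[0,1],[1,0]]` (its own inverse). [folklore] -/
def flipMat : Matrix (Fin 2) (Fin 2) ℂ := !![0, 1; 1, 0]

/-- `σ² = 1`. [folklore] -/
theorem flipMat_mul_self : flipMat * flipMat = 1 := by
  ext i j; fin_cases i <;> fin_cases j <;> simp [flipMat, Matrix.mul_apply, Fin.sum_univ_two]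

/-- `σ ∈ GL₂(ℂ)`. [folklore] -/
def flip : GLTwo' := ⟨flipMat, flipMat, flipMat_mul_self, flipMat_mul_self⟩

/-- The matrix of `σ`. -/
@[simp] theorem coe_flip : ((flip : GLTwo') : Matrix (Fin 2) (Fin 2) ℂ) = flipMat := rfl

/-- `σ⁻¹ = σ`. [folklore] -/
theorem flip_inv : (flip : GLTwo')⁻¹ = flip :=
  inv_eq_of_mul_eq_one_right (Units.ext flipMat_mul_self)

/-- The cell function `φ(g) = g₁₁` vanishes on `B⁻ σ B⁺`: for `x` lower triangular and `c` upper
triangular, `(x σ c)₁₁ = 0`. [folklore: the Bruhat cell `B⁻σB⁺` of `GL₂` misses the big cell] -/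
theorem flip_cell_entry (x c : Matrix (Fin 2) (Fin 2) ℂ) (hx : x 0 1 = 0) (hc : c 1 0 = 0) :
    (x * flipMat * c) 0 0 = 0 := by
  simp [Matrix.mul_apply, Fin.sum_univ_two, flipMat, hx, hc]

/-- … and is `x₁₁ c₁₁` on the big cell: `(x c)₁₁ = x₁₁ c₁₁` for `x` lower triangular.
[folklore] -/
theorem big_cell_entry (x c : Matrix (Fin 2) (Fin 2) ℂ) (hx : x 0 1 = 0) :
    (x * c) 0 0 = x 0 0 * c 0 0 := by
  simp [Matrix.mul_apply, Fin.sum_univ_two, hx]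

/-- `B⁻ × U⁺ → GL₂` is injective (`B⁻ ∩ U⁺ = 1`), with entries: `a c = a' c'` for `a, a'` lower
triangular with `a₁₁ ≠ 0` and `c, c'` upper unitriangular forces `a = a'`, `c = c'`. [folklore] -/
theorem lowerTri_mul_upperUni_inj (a a' c c' : Matrix (Fin 2) (Fin 2) ℂ)
    (ha : a 0 1 = 0) (ha' : a' 0 1 = 0) (ha00 : a 0 0 ≠ 0)
    (hc : c 1 0 = 0 ∧ c 0 0 = 1 ∧ c 1 1 = 1) (hc' : c' 1 0 = 0 ∧ c' 0 0 = 1 ∧ c' 1 1 = 1)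
    (h : a * c = a' * c') : a = a' ∧ c = c' := by
  obtain ⟨hc10, hc00, hc11⟩ := hc
  obtain ⟨hc10', hc00', hc11'⟩ := hc'
  have e00 := congrFun (congrFun h 0) 0
  have e01 := congrFun (congrFun h 0) 1
  have e10 := congrFun (congrFun h 1) 0
  have e11 := congrFun (congrFun h 1) 1
  simp only [Matrix.mul_apply, Fin.sum_univ_two, ha, ha', hc10, hc00, hc11, hc10', hc00', hc11',
    mul_one, mul_zero, add_zero] at e00 e01 e10 e11
  have f01 : c 0 1 = c' 0 1 := by rw [← e00] at e01; exact mul_left_cancel₀ ha00 e01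
  have f11 : a 1 1 = a' 1 1 := by rw [e10, f01] at e11; exact add_left_cancel e11
  refine ⟨?_, ?_⟩
  · rw [Matrix.eta_fin_two a, Matrix.eta_fin_two a']
    rw [e00, ha, ha', e10, f11]
  · rw [Matrix.eta_fin_two c, Matrix.eta_fin_two c']
    rw [hc00, hc00', f01, hc10, hc10', hc11, hc11']

/-- A lower-triangular element of `GL₂` has `x₁₁ ≠ 0`. [folklore] -/
theorem glTwo_lowerTri_entry_ne_zero (x : GLTwo') (hx : (x : Matrix (Fin 2) (Fin 2) ℂ) 0 1 = 0) :
    (x : Matrix (Fin 2) (Fin 2) ℂ) 0 0 ≠ 0 := by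
  intro h0
  have hdet : IsUnit (x : Matrix (Fin 2) (Fin 2) ℂ).det :=
    (Matrix.isUnit_iff_isUnit_det _).mp x.isUnit
  apply hdet.ne_zero
  rw [Matrix.det_fin_two, h0, hx]; ring

/-- The two cell conditions for the flip design: `φ = g₁₁` vanishes at the twisted points
`x y⁻¹ y' z⁻¹` (`y ≠ y'` in `{1, σ}`, `x ∈ B⁻`, `z⁻¹ ∈ B⁺`) and not at `x z⁻¹` (`z⁻¹ ∈ U⁺`).
[new] -/
theorem glTwo_flip_cell {X Z : Finset GLTwo'}
    (hX : ∀ x ∈ X, (x : Matrix (Fin 2) (Fin 2) ℂ) 0 1 = 0)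
    (hZ : ∀ z ∈ Z, ((z⁻¹ : GLTwo') : Matrix (Fin 2) (Fin 2) ℂ) 1 0 = 0 ∧
      ((z⁻¹ : GLTwo') : Matrix (Fin 2) (Fin 2) ℂ) 0 0 = 1 ∧
      ((z⁻¹ : GLTwo') : Matrix (Fin 2) (Fin 2) ℂ) 1 1 = 1) :
    (∀ x ∈ X, ∀ y ∈ ({1, flip} : Finset GLTwo'), ∀ y' ∈ ({1, flip} : Finset GLTwo'), ∀ z ∈ Z,
      y ≠ y' → ((x * y⁻¹ * y' * z⁻¹ : GLTwo') : Matrix (Fin 2) (Fin 2) ℂ) 0 0 = 0) ∧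
    (∀ x ∈ X, ∀ z ∈ Z, ((x * z⁻¹ : GLTwo') : Matrix (Fin 2) (Fin 2) ℂ) 0 0 ≠ 0) := by
  classical
  refine ⟨?_, ?_⟩
  · intro x hx y hy y' hy' z hz hne
    simp only [Finset.mem_insert, Finset.mem_singleton] at hy hy'
    have hw : y⁻¹ * y' = flip := by
      rcases hy with rfl | rfl <;> rcases hy' with rfl | rfl
      · exact absurd rfl hne
      · simp
      · rw [flip_inv, mul_one]
      · exact absurd rfl hne
    rw [mul_assoc x, hw]
    simp only [Units.val_mul, coe_flip]
    exact flip_cell_entry _ _ (hX x hx) (hZ z hz).1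
  · intro x hx z hz
    simp only [Units.val_mul]
    rw [big_cell_entry _ _ (hX x hx), (hZ z hz).2.1, mul_one]
    exact glTwo_lowerTri_entry_ne_zero x (hX x hx)

/-- **The flip design satisfies the TPP.** `X ⊆ B⁻` (lower triangular), `Z⁻¹ ⊆ U⁺` (upper
unitriangular), `Y = {1, σ}`: for ANY such finite `X, Z` the triple has the TPP (embedding form).
[new] -/
theorem glTwo_flip_tpp {X Z : Finset GLTwo'}
    (hX : ∀ x ∈ X, (x : Matrix (Fin 2) (Fin 2) ℂ) 0 1 = 0)
    (hZ : ∀ z ∈ Z, ((z⁻¹ : GLTwo') : Matrix (Fin 2) (Fin 2) ℂ) 1 0 = 0 ∧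
      ((z⁻¹ : GLTwo') : Matrix (Fin 2) (Fin 2) ℂ) 0 0 = 1 ∧
      ((z⁻¹ : GLTwo') : Matrix (Fin 2) (Fin 2) ℂ) 1 1 = 1) :
    ∀ x ∈ X, ∀ x' ∈ X, ∀ y ∈ ({1, flip} : Finset GLTwo'), ∀ y' ∈ ({1, flip} : Finset GLTwo'),
      ∀ z ∈ Z, ∀ z' ∈ Z, x * y⁻¹ * y' * z⁻¹ = x' * z'⁻¹ → x = x' ∧ y = y' ∧ z = z' := by
  obtain ⟨hN, hQ⟩ := glTwo_flip_cell hX hZ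
  refine tpp_of_cellFunction (fun g : GLTwo' => (g : Matrix (Fin 2) (Fin 2) ℂ) 0 0) hN hQ ?_
  intro x hx x' hx' z hz z' hz' heq
  have hm : (x : Matrix (Fin 2) (Fin 2) ℂ) * ((z⁻¹ : GLTwo') : Matrix (Fin 2) (Fin 2) ℂ) =
      (x' : Matrix (Fin 2) (Fin 2) ℂ) * ((z'⁻¹ : GLTwo') : Matrix (Fin 2) (Fin 2) ℂ) := by
    have := congrArg (fun g : GLTwo' => (g : Matrix (Fin 2) (Fin 2) ℂ)) heq
    simpa only [Units.val_mul] using this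
  obtain ⟨hxx, hcc⟩ := lowerTri_mul_upperUni_inj _ _ _ _ (hX x hx) (hX x' hx')
    (glTwo_lowerTri_entry_ne_zero x (hX x hx)) (hZ z hz) (hZ z' hz') hm
  exact ⟨Units.ext hxx, inv_injective (Units.ext hcc)⟩

/-- **The flip design is separated by `g₁₁ · (interpolant)`.** With `X, Z` as above and any family
`g` interpolating on `Q = X Z⁻¹`, the functions `t ↦ ((x z⁻¹)₁₁)⁻¹ · t₁₁ · g_{xz}(t)` are a
separating family for `(X, {1,σ}, Z)`; if the `g_{xz}` are entry polynomials of degree `≤ s − 1`,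
these are entry polynomials of degree `≤ s`, and the design has volume `2 |X| |Z|`. [new] -/
theorem glTwo_flip_separating {X Z : Finset GLTwo'}
    (hX : ∀ x ∈ X, (x : Matrix (Fin 2) (Fin 2) ℂ) 0 1 = 0)
    (hZ : ∀ z ∈ Z, ((z⁻¹ : GLTwo') : Matrix (Fin 2) (Fin 2) ℂ) 1 0 = 0 ∧
      ((z⁻¹ : GLTwo') : Matrix (Fin 2) (Fin 2) ℂ) 0 0 = 1 ∧
      ((z⁻¹ : GLTwo') : Matrix (Fin 2) (Fin 2) ℂ) 1 1 = 1)
    (g : GLTwo' → GLTwo' → (GLTwo' → ℂ))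
    (hg : ∀ x ∈ X, ∀ z ∈ Z, ∀ x' ∈ X, ∀ z' ∈ Z,
      g x z (x' * z'⁻¹) = if x = x' ∧ z = z' then 1 else 0) :
    IsSeparatingFamily X ({1, flip} : Finset GLTwo') Z
      (fun x z t => (((x * z⁻¹ : GLTwo') : Matrix (Fin 2) (Fin 2) ℂ) 0 0)⁻¹ *
        (((t : GLTwo') : Matrix (Fin 2) (Fin 2) ℂ) 0 0 * g x z t)) := by
  obtain ⟨hN, hQ⟩ := glTwo_flip_cell hX hZ
  exact isSeparatingFamily_of_cellFunction
    (fun g : GLTwo' => (g : Matrix (Fin 2) (Fin 2) ℂ) 0 0) hN hQ g hg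

end Summit.MatrixMultiplication.MatrixMultiplication.Theorems

end
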